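import Summits.Ventures.HSemireg.CechCupOneAnticomm
import HarnessLib

/-!
# Venture HSemireg — route R1.0, rows `q ≥ 2`: Čech `1`-cocycles anticommuting UP TO A COBOUNDARY have
# commuting cup classes (th-4; the cup-one homotopy of `CechCupOneAnticomm` with a correction cochain)

HONEST FRAMING. An abstract identity of Čech cochains of local homomorphisms between `𝒪_Y`-modules on a scheme
`Y` (`Modules/CechCup`, `CechCupOneAnticomm`). Nothing about any variety; nothing here says HC, HC_CM or HC_AV is
proved.

WHAT IS PROVED (`namespace Summit.Ventures.HSemireg.Cech`). For `1`-cochains `a : A → B`, `s' : B → C`, `s : A → B'`,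
`a' : B' → C` and a CORRECTION `1`-cochain `G : A → C` on one cover `U`:

* `cupFamily_eq_add_dFamily_of_anticomm_add` — if `a`, `s'` are cocycles and on every triangle
  `a'_{yz}(s_{xy} x) = -s'_{xy}(a_{yz} x) + (dG)_{xyz}(x)`, then `s ∪ a' = a ∪ s' + d(a ∪₁ s' + G)` with the cup-one
  product `(a ∪₁ s')_{xy} = a_{xy} ≫ s'_{xy}` (`CechCupOneAnticomm` is the case `G = 0`);
* `classOf_cupFamily_eq_of_anticomm_add`, `comp_classOf_eq_of_anticomm_add` — hence `[s ∪ a'] = [a ∪ s']` and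
  **`[s] · [a'] = [a] · [s']` in `Ext²(A, C)`** (Mathlib `Ext.comp` order).

This is the form the Atiyah steps need WITHOUT common coframes: with independent coframes on the opens the level-`j`
and `(j+1)` Atiyah cocycles anticommute with `θ_{xy} ∧ –` only up to `T_y(θ_{xy}) - T_z(θ_{xy})` for coframe-transfer
operators `T_x`, and `G_{xy} = T_y(θ_{xy})` has `(dG)_{xyz} = T_y(θ_{xy}) - T_z(θ_{xy})` by the cocycle relation
`θ_{xz} = θ_{xy} + θ_{yz}` and the additivity of `T_z`.

## References

* R. Godement, *Topologie algébrique et théorie des faisceaux* (1958), II.6 (cup products of Čech cochains and their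
  commutativity up to homotopy).
* R. Hartshorne, *Algebraic Geometry* (1977), III.4 (Čech cohomology). [Hartshorne1977]
-/

set_option backward.isDefEq.respectTransparency false

noncomputable section

universe u

open CategoryTheory CategoryTheory.Abelian AlgebraicGeometry Opposite TopologicalSpace Limits

namespace Summit.Ventures.HSemireg

namespace Cech

open Literature.AlgebraicGeometry.Modules Literature.AlgebraicGeometry.Modules.Cech

variable {Y : Scheme.{u}} {ι : Type u} {U : ι → Y.Opens} {A B B' C : Y.Modules}
  (a : LocalFamily U 1 A B) (s' : LocalFamily U 1 B C) (s : LocalFamily U 1 A B') (a' : LocalFamily U 1 B' C)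
  (G : LocalFamily U 1 A C)

/-- **Cocycles anticommuting up to a coboundary**: `s ∪ a' = a ∪ s' + d(a ∪₁ s' + G)` whenever
`a'_{yz} ∘ s_{xy} = -s'_{xy} ∘ a_{yz} + (dG)_{xyz}` on every triangle and `a`, `s'` are cocycles. [folklore] -/
theorem cupFamily_eq_add_dFamily_of_anticomm_add (ha : dFamily a = 0) (hs' : dFamily s' = 0)
    (H : ∀ (τ : Fin 3 → ι) {W : Y.Opens} (k : W ⟶ face U τ) (x : Γ(A, W)),
      appLE (a' (back 1 τ)) (k ≫ homOfLE (face_le_face_back U 1 τ))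
          (appLE (s (front τ)) (k ≫ homOfLE (face_le_face_front U τ)) x) =
        -appLE (s' (front τ)) (k ≫ homOfLE (face_le_face_front U τ))
          (appLE (a (back 1 τ)) (k ≫ homOfLE (face_le_face_back U 1 τ)) x) + appLE (dFamily G τ) k x) :
    cupFamily a' s = cupFamily s' a + dFamily ((fun β => a β ≫ s' β : LocalFamily U 1 A C) + G) := by
  funext τ
  refine hom_ext_of_appLE fun W k x => ?_
  rw [appLE_cupFamily, H τ k x, dFamily_add]
  change _ = appLE (cupFamily s' a τ +
    (dFamily (fun β => a β ≫ s' β : LocalFamily U 1 A C) τ + dFamily G τ)) k x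
  rw [appLE_add, appLE_add]
  generalize appLE (dFamily G τ) k x = g
  rw [appLE_cupFamily, dFamily, appLE_sum, Fin.sum_univ_three, appLE_zsmul, appLE_zsmul,
    appLE_zsmul, appLE_restrictHom, appLE_restrictHom, appLE_restrictHom]
  simp only [Fin.val_zero, pow_zero, one_smul, Fin.val_one, pow_one, neg_one_zsmul, Fin.val_two, neg_one_sq,
    appLE_comp]
  -- names for the inclusions of `W` into the three edges
  set k₀ := k ≫ homOfLE (face_le_face_comp U τ (Fin.succAbove 0))
  set k₁ := k ≫ homOfLE (face_le_face_comp U τ (Fin.succAbove 1))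
  set k₂ := k ≫ homOfLE (face_le_face_comp U τ (Fin.succAbove 2))
  -- move the `front`/`back` values to the `δ₂`/`δ₀` edges
  rw [appLE_family_congr a (front_eq_comp_succAbove_two τ) _ k₂,
    appLE_family_congr s' (back_one_eq_comp_succAbove_zero τ) _ k₀,
    appLE_family_congr a (back_one_eq_comp_succAbove_zero τ) _ k₀,
    appLE_family_congr s' (front_eq_comp_succAbove_two τ) _ k₂]
  -- the two cocycle identities
  have hca : appLE (a (τ ∘ Fin.succAbove 1)) k₁ x =
      appLE (a (τ ∘ Fin.succAbove 0)) k₀ x + appLE (a (τ ∘ Fin.succAbove 2)) k₂ x := by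
    have h := cocycle_apply a ha τ k k₀ k₁ k₂ x
    rw [sub_add_eq_add_sub, sub_eq_zero] at h
    exact h.symm
  have hcs : ∀ y : Γ(B, W), appLE (s' (τ ∘ Fin.succAbove 1)) k₁ y =
      appLE (s' (τ ∘ Fin.succAbove 0)) k₀ y + appLE (s' (τ ∘ Fin.succAbove 2)) k₂ y := fun y => by
    have h := cocycle_apply s' hs' τ k k₀ k₁ k₂ y
    rw [sub_add_eq_add_sub, sub_eq_zero] at h
    exact h.symm
  rw [hca, hcs, appLE_add_right, appLE_add_right]
  abel

variable [HasExt.{u + 1} Y.Modules]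

/-- Hence **the cup classes agree**: `[s ∪ a'] = [a ∪ s']`. [folklore] -/
theorem classOf_cupFamily_eq_of_anticomm_add (c : Literature.Algebra.Homology.ExactAugmentation (complex U C) C)
    (ha : dFamily a = 0) (hs' : dFamily s' = 0) (hs : dFamily s = 0) (ha' : dFamily a' = 0)
    (H : ∀ (τ : Fin 3 → ι) {W : Y.Opens} (k : W ⟶ face U τ) (x : Γ(A, W)),
      appLE (a' (back 1 τ)) (k ≫ homOfLE (face_le_face_back U 1 τ))
          (appLE (s (front τ)) (k ≫ homOfLE (face_le_face_front U τ)) x) =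
        -appLE (s' (front τ)) (k ≫ homOfLE (face_le_face_front U τ))
          (appLE (a (back 1 τ)) (k ≫ homOfLE (face_le_face_back U 1 τ)) x) + appLE (dFamily G τ) k x) :
    classOf c (cupFamily a' s) (dFamily_cupFamily a' ha' s hs) =
      classOf c (cupFamily s' a) (dFamily_cupFamily s' hs' a ha) :=
  classOf_eq_of_eq_add_dFamily c ((fun β => a β ≫ s' β : LocalFamily U 1 A C) + G) _ _
    (cupFamily_eq_add_dFamily_of_anticomm_add a s' s a' G ha hs' H)

/-- **Cocycles anticommuting up to a coboundary have commuting Yoneda composites**: `[s] · [a'] = [a] · [s']` in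
`Ext²(A, C)`. [folklore] -/
theorem comp_classOf_eq_of_anticomm_add
    (b : Literature.Algebra.Homology.ExactAugmentation (complex U B) B)
    (b' : Literature.Algebra.Homology.ExactAugmentation (complex U B') B')
    (c : Literature.Algebra.Homology.ExactAugmentation (complex U C) C)
    (hb : b.ε = augment U B) (hb' : b'.ε = augment U B')
    (ha : dFamily a = 0) (hs' : dFamily s' = 0) (hs : dFamily s = 0) (ha' : dFamily a' = 0)
    (H : ∀ (τ : Fin 3 → ι) {W : Y.Opens} (k : W ⟶ face U τ) (x : Γ(A, W)),
      appLE (a' (back 1 τ)) (k ≫ homOfLE (face_le_face_back U 1 τ))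
          (appLE (s (front τ)) (k ≫ homOfLE (face_le_face_front U τ)) x) =
        -appLE (s' (front τ)) (k ≫ homOfLE (face_le_face_front U τ))
          (appLE (a (back 1 τ)) (k ≫ homOfLE (face_le_face_back U 1 τ)) x) + appLE (dFamily G τ) k x) :
    (classOf b' s hs).comp (classOf c a' ha') rfl = (classOf b a ha).comp (classOf c s' hs') rfl := by
  rw [← classOf_cupFamily a' b' c hb' ha' s hs, ← classOf_cupFamily s' b c hb hs' a ha]
  exact classOf_cupFamily_eq_of_anticomm_add a s' s a' G c ha hs' hs ha' H

end Cech

end Summit.Ventures.HSemireg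

end
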